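import Literature.AnabelianGeometry.EtaleTheta.FrobenioidThetaOfThetaEnvData
import Literature.AnabelianGeometry.EtaleTheta.Discharge.Sec5BiKummerSections
import Literature.AnabelianGeometry.EtaleTheta.Discharge.Sec5AutAmple

/-!
# [EtTh] §5 merge adapter (MERGE-PLAN §2a, bi-Kummer block): §5 data whose `s^⊓-gp_N, s^⊔-gp_N` ARE the unique lifts of p.331 (pp. 330–331 / PDF pp. 104–105)

Mochizuki, *The étale theta function …*, Publ. RIMS **45** (2009)
[cite: MochizukiEtTh2009, §5 p.331 (PDF p.105)].  Seat abc-iut-L2-t4 (§5 owner), MERGE-PLAN §2a (HOME/staging/L2/L2-t4/MERGE-PLAN.md).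
ADDITIVE: a CONSTRUCTOR for `ThetaFrobenioid` (FrobenioidTheta.lean, FROZEN) + theorems about its values; nothing landed is edited.

In abc-iut-L2-t4's typing the bi-Kummer sections `s^⊓-gp_N : Aut_D(B_N^bs) → Aut_C(B_N)`, `s^⊔-gp_N : H_{B_N} → Aut_C(B_N)` are
DATA, and their printed defining relations (p.331 (PDF p.105): "`s^trv_N` determines [unique] group homomorphisms … such that
`s^⊓-gp_N(g) ∘ s^⊓_N = s^⊓_N ∘ (s^trv_N|…)(g)`, `s^⊔-gp_N(h) ∘ s^⊔_N = s^⊔_N ∘ (s^trv_N|_{H_{B_N}})(h)`") are the named inputs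
`SgpCapSpec`, `SgpCupSpec` of every §5 discharge.  `Discharge/Sec5BiKummerSections.lean` PROVED that these homomorphisms
EXIST UNIQUELY (`liftAlong`) under print's sufficient condition (proof of Prop. 4.3 (i), p.317 (PDF p.91): the divisors
`Div(s^⊓_N)`, `Div(s^⊔_N)` are fixed — [FrdI] Def. 1.3 (iii)(d) + total epimorphicity; §5 p.330 (PDF p.104): `Div(s^⊓_N)`
"descends … to `Φ(A_⊚)`").  This file builds the §5 data WITH `s^⊓-gp_N, s^⊔-gp_N :=` those lifts
(`ThetaFrobenioid.ofRootData`, over the Π-block constructor `ofThetaEnvData` of `FrobenioidThetaOfThetaEnvData.lean`) and PROVES,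
for such data: `SgpCapSpec`, `SgpCupSpec` (now THEOREMS: `sgpCapSpec_ofRootData`, `sgpCupSpec_ofRootData`), `StrvSection` from the
section property of the base-Frobenius pair `σ = s^trv_N` ([FrdI] Prop. 5.6; input `hσ`), hence `SgpCapSection`, "`B_N` is
Aut-ample" (`autAmpleBN_ofRootData`), and the bundle of §5 named inputs `Facts` from ONLY the two remaining printed facts
`BiKummerDifferenceMem` (Prop. 4.3 (iii)) and `ConstantsActByCyclotome` (Lemma 5.8, arithmetic step) (`facts_ofRootData`).
Construction note (honest): `liftAlong` is stated over ambient §5 data; the lifts are therefore computed on the auxiliary data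
`ofRootData.aux` (same fields, trivial placeholder sections — never exposed as §5 data) and then installed; all statements below
are about the final `ofRootData`.  HONEST FRAMING: a constructor and kernel-checked consequences for data so constructed; the
hypotheses are the printed [FrdI]/§1 inputs listed; nothing of [EtTh] is asserted unconditionally; no side is taken downstream.
-/

namespace Literature.AnabelianGeometry.EtaleTheta

open CategoryTheory

universe w v v' u u'

namespace ThetaFrobenioid

variable {C : Type u} [Category.{v} C] {D : Type u'} [Category.{v'} D]

section

variable (F : FrobenioidTheta.TemperedFrobenioidStub.{w} C D) (Q : FrobenioidTheta.ThetaSubquotientStub.{w} D)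
  (l : ℕ) (odd_l : Odd l) (N : ℕ+) (T : ThetaEnvData.{v} N) (Acirc AN BN : C) (sCap sCup : AN ⟶ BN)
  (base_map_sCap : F.pre.base.map sCap = F.pre.base.map sCup)
  (isPreStep_sCap : F.pre.IsPreStep sCap) (isPreStep_sCup : F.pre.IsPreStep sCup)
  (ρ : T.PiX →* Aut (F.pre.base.obj BN)) (ρ_surjective : Function.Surjective ρ)
  (isOpen_ker_ρ : IsOpen (ρ.ker : Set T.PiX)) (σ : Aut (F.pre.base.obj AN) →* Aut AN)
  (K : Type w) [Field K] (constEmb : Kˣ →* F.biratUnits BN) (constEmb_injective : Function.Injective constEmb)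
  (thetaFn : F.biratUnits Acirc)

/-- Auxiliary §5 data with PLACEHOLDER sections `s^⊓-gp_N = s^⊔-gp_N := 1` (used only to evaluate the level-free
ingredients `autBaseIsoAB`, `HB`, `IsPreStep` at the right types; never a §5 datum in its own right).
[cite: MochizukiEtTh2009, §5 p.331 (PDF p.105)] -/
noncomputable def ofRootData.aux : ThetaFrobenioid.{w} C D :=
  ofThetaEnvData F Q l odd_l N T Acirc AN BN sCap sCup base_map_sCap isPreStep_sCap isPreStep_sCup ρ ρ_surjective
    isOpen_ker_ρ σ 1 1 K constEmb constEmb_injective thetaFn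

variable (hepi : ∀ ⦃X Y : C⦄ (f : X ⟶ Y), Epi f) (hiso : F.pre.IsOfIsotropicType)
  (hiiid : ∀ ⦃A B B' : C⦄ (φ : A ⟶ B) (φ' : A ⟶ B'), F.pre.IsCoAngularPreStep φ →
    F.pre.IsCoAngularPreStep φ' → F.pre.div φ ∣ F.pre.div φ' →
      ∃ f : B ⟶ B', F.pre.IsCoAngularPreStep f ∧ φ ≫ f = φ')
  (hdivc : ∀ g : Aut (F.pre.base.obj BN),
    F.pre.div ((σ ((ofRootData.aux F Q l odd_l N T Acirc AN BN sCap sCup base_map_sCap isPreStep_sCap isPreStep_sCup ρ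
      ρ_surjective isOpen_ker_ρ σ K constEmb constEmb_injective thetaFn).autBaseIsoAB.symm g)).hom ≫ sCap) = F.pre.div sCap)
  (hdivp : ∀ h : (ofRootData.aux F Q l odd_l N T Acirc AN BN sCap sCup base_map_sCap isPreStep_sCap isPreStep_sCup ρ
      ρ_surjective isOpen_ker_ρ σ K constEmb constEmb_injective thetaFn).HB,
    F.pre.div ((σ ((ofRootData.aux F Q l odd_l N T Acirc AN BN sCap sCup base_map_sCap isPreStep_sCap isPreStep_sCup ρ
      ρ_surjective isOpen_ker_ρ σ K constEmb constEmb_injective thetaFn).autBaseIsoAB.symm h.1)).hom ≫ sCup) =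
      F.pre.div sCup)

/-- **§5 data with the bi-Kummer sections DEFINED as print prescribes** (p.331 (PDF p.105)): over the Π-block of a §2
`ThetaEnvData T` (`ofThetaEnvData`), with `s^trv_N := σ` and `s^⊓-gp_N`, `s^⊔-gp_N` := the UNIQUE homomorphisms with
`x(g) ∘ s^⊓_N = s^⊓_N ∘ σ(g')` on `Aut_D(B_N^bs)`, resp. `x(h) ∘ s^⊔_N = s^⊔_N ∘ σ(h')` on `H_{B_N}`
(`Discharge/Sec5BiKummerSections.liftAlong`), which exist because `Div(s^⊓_N)`, `Div(s^⊔_N)` are fixed (`hdivc`, `hdivp` — §5 p.330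
(PDF p.104) / Prop. 4.3 (i) proof p.317 (PDF p.91)) in a totally epimorphic Frobenioid of isotropic type with [FrdI] Def. 1.3 (iii)(d)
(`hepi`, `hiso`, `hiiid`).  [cite: MochizukiEtTh2009, §5 p.330–331 (PDF pp.104–105); Prop 4.3 (i) p.316–317 (PDF pp.90–91)] -/
noncomputable def ofRootData : ThetaFrobenioid.{w} C D :=
  ofThetaEnvData F Q l odd_l N T Acirc AN BN sCap sCup base_map_sCap isPreStep_sCap isPreStep_sCup ρ ρ_surjective
    isOpen_ker_ρ σ
    (liftAlong (𝔉 := ofRootData.aux F Q l odd_l N T Acirc AN BN sCap sCup base_map_sCap isPreStep_sCap isPreStep_sCup ρ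
        ρ_surjective isOpen_ker_ρ σ K constEmb constEmb_injective thetaFn) hepi hiso hiiid
      ((ofRootData.aux F Q l odd_l N T Acirc AN BN sCap sCup base_map_sCap isPreStep_sCap isPreStep_sCup ρ
        ρ_surjective isOpen_ker_ρ σ K constEmb constEmb_injective thetaFn).strv.comp
        (ofRootData.aux F Q l odd_l N T Acirc AN BN sCap sCup base_map_sCap isPreStep_sCap isPreStep_sCup ρ
          ρ_surjective isOpen_ker_ρ σ K constEmb constEmb_injective thetaFn).autBaseIsoAB.symm.toMonoidHom)
      isPreStep_sCap hdivc)
    (liftAlong (𝔉 := ofRootData.aux F Q l odd_l N T Acirc AN BN sCap sCup base_map_sCap isPreStep_sCap isPreStep_sCup ρ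
        ρ_surjective isOpen_ker_ρ σ K constEmb constEmb_injective thetaFn) hepi hiso hiiid
      (((ofRootData.aux F Q l odd_l N T Acirc AN BN sCap sCup base_map_sCap isPreStep_sCap isPreStep_sCup ρ
        ρ_surjective isOpen_ker_ρ σ K constEmb constEmb_injective thetaFn).strv.comp
        (ofRootData.aux F Q l odd_l N T Acirc AN BN sCap sCup base_map_sCap isPreStep_sCap isPreStep_sCup ρ
          ρ_surjective isOpen_ker_ρ σ K constEmb constEmb_injective thetaFn).autBaseIsoAB.symm.toMonoidHom).comp
        (ofRootData.aux F Q l odd_l N T Acirc AN BN sCap sCup base_map_sCap isPreStep_sCap isPreStep_sCup ρ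
          ρ_surjective isOpen_ker_ρ σ K constEmb constEmb_injective thetaFn).HB.subtype)
      isPreStep_sCup hdivp)
    K constEmb constEmb_injective thetaFn

/-- **`SgpCapSpec` is a THEOREM for `ofRootData`** — the printed defining relation of `s^⊓-gp_N` (p.331 (PDF p.105)).
[cite: MochizukiEtTh2009, §5 p.331 (PDF p.105)] -/
theorem sgpCapSpec_ofRootData :
    (ofRootData F Q l odd_l N T Acirc AN BN sCap sCup base_map_sCap isPreStep_sCap isPreStep_sCup ρ ρ_surjective
      isOpen_ker_ρ σ K constEmb constEmb_injective thetaFn hepi hiso hiiid hdivc hdivp).SgpCapSpec :=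
  fun g => liftAlong_spec (𝔉 := (ofRootData.aux F Q l odd_l N T Acirc AN BN sCap sCup base_map_sCap isPreStep_sCap isPreStep_sCup ρ
      ρ_surjective isOpen_ker_ρ σ K constEmb constEmb_injective thetaFn)) hepi hiso hiiid _ isPreStep_sCap hdivc g

/-- **`SgpCupSpec` is a THEOREM for `ofRootData`** — the printed defining relation of `s^⊔-gp_N` (p.331 (PDF p.105)).
[cite: MochizukiEtTh2009, §5 p.331 (PDF p.105)] -/
theorem sgpCupSpec_ofRootData :
    (ofRootData F Q l odd_l N T Acirc AN BN sCap sCup base_map_sCap isPreStep_sCap isPreStep_sCup ρ ρ_surjective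
      isOpen_ker_ρ σ K constEmb constEmb_injective thetaFn hepi hiso hiiid hdivc hdivp).SgpCupSpec :=
  fun h => liftAlong_spec (𝔉 := (ofRootData.aux F Q l odd_l N T Acirc AN BN sCap sCup base_map_sCap isPreStep_sCap isPreStep_sCup ρ
      ρ_surjective isOpen_ker_ρ σ K constEmb constEmb_injective thetaFn)) hepi hiso hiiid _ isPreStep_sCup hdivp h

/-- `StrvSection` for `ofRootData` from the section property of the base-Frobenius pair `σ` of `A_N` ([FrdI] Prop. 5.6:
`σ : Aut_D(A_N^bs) → Aut_C(A_N)` splits `Aut_C(A_N) → Aut_D(A_N^bs)`; input `hσ`).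
[cite: MochizukiEtTh2009, §5 p.330–331 (PDF pp.104–105)] -/
theorem strvSection_ofRootData (hσ : ∀ g : Aut (F.pre.base.obj AN), F.pre.base.mapAut AN (σ g) = g) :
    (ofRootData F Q l odd_l N T Acirc AN BN sCap sCup base_map_sCap isPreStep_sCap isPreStep_sCup ρ ρ_surjective
      isOpen_ker_ρ σ K constEmb constEmb_injective thetaFn hepi hiso hiiid hdivc hdivp).StrvSection :=
  hσ

/-- Hence `SgpCapSection` for `ofRootData` (`(s^⊓-gp_N(g))^bs = g`). [cite: MochizukiEtTh2009, §5 p.331 (PDF p.105)] -/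
theorem sgpCapSection_ofRootData (hσ : ∀ g : Aut (F.pre.base.obj AN), F.pre.base.mapAut AN (σ g) = g) :
    (ofRootData F Q l odd_l N T Acirc AN BN sCap sCup base_map_sCap isPreStep_sCap isPreStep_sCup ρ ρ_surjective
      isOpen_ker_ρ σ K constEmb constEmb_injective thetaFn hepi hiso hiiid hdivc hdivp).SgpCapSection :=
  sgpCapSection_of _ (sgpCapSpec_ofRootData F Q l odd_l N T Acirc AN BN sCap sCup base_map_sCap isPreStep_sCap
    isPreStep_sCup ρ ρ_surjective isOpen_ker_ρ σ K constEmb constEmb_injective thetaFn hepi hiso hiiid hdivc hdivp)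
    (strvSection_ofRootData F Q l odd_l N T Acirc AN BN sCap sCup base_map_sCap isPreStep_sCap isPreStep_sCup ρ
      ρ_surjective isOpen_ker_ρ σ K constEmb constEmb_injective thetaFn hepi hiso hiiid hdivc hdivp hσ)

/-- Hence "`B_N` is Aut-ample" for `ofRootData` (p.330 (PDF p.104)). [cite: MochizukiEtTh2009, §5 p.330 (PDF p.104)] -/
theorem autAmpleBN_ofRootData (hσ : ∀ g : Aut (F.pre.base.obj AN), F.pre.base.mapAut AN (σ g) = g) :
    (ofRootData F Q l odd_l N T Acirc AN BN sCap sCup base_map_sCap isPreStep_sCap isPreStep_sCup ρ ρ_surjective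
      isOpen_ker_ρ σ K constEmb constEmb_injective thetaFn hepi hiso hiiid hdivc hdivp).AutAmpleBN :=
  autAmpleBN_of_sgpCapSection _ (sgpCapSection_ofRootData F Q l odd_l N T Acirc AN BN sCap sCup base_map_sCap
    isPreStep_sCap isPreStep_sCup ρ ρ_surjective isOpen_ker_ρ σ K constEmb constEmb_injective thetaFn hepi hiso hiiid
    hdivc hdivp hσ)

/-- **The bundle of §5 named inputs for `ofRootData` from TWO printed facts only**: the bi-Kummer cocycle
(`BiKummerDifferenceMem`, Prop. 4.3 (iii)) and the arithmetic step of Lemma 5.8 (`ConstantsActByCyclotome`) — the defining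
relations, the section property, Aut-ampleness and total epimorphicity being THEOREMS / constructor inputs here.
[cite: MochizukiEtTh2009, §5 p.330–331 (PDF pp.104–105)] -/
theorem facts_ofRootData (hσ : ∀ g : Aut (F.pre.base.obj AN), F.pre.base.mapAut AN (σ g) = g)
    (hdiff : (ofRootData F Q l odd_l N T Acirc AN BN sCap sCup base_map_sCap isPreStep_sCap isPreStep_sCup ρ
      ρ_surjective isOpen_ker_ρ σ K constEmb constEmb_injective thetaFn hepi hiso hiiid hdivc hdivp).BiKummerDifferenceMem)
    (hK : (ofRootData F Q l odd_l N T Acirc AN BN sCap sCup base_map_sCap isPreStep_sCap isPreStep_sCup ρ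
      ρ_surjective isOpen_ker_ρ σ K constEmb constEmb_injective thetaFn hepi hiso hiiid hdivc hdivp).ConstantsActByCyclotome) :
    (ofRootData F Q l odd_l N T Acirc AN BN sCap sCup base_map_sCap isPreStep_sCap isPreStep_sCup ρ ρ_surjective
      isOpen_ker_ρ σ K constEmb constEmb_injective thetaFn hepi hiso hiiid hdivc hdivp).Facts :=
  Facts.of_totallyEpi _ hepi
    (sgpCapSpec_ofRootData F Q l odd_l N T Acirc AN BN sCap sCup base_map_sCap isPreStep_sCap isPreStep_sCup ρ
      ρ_surjective isOpen_ker_ρ σ K constEmb constEmb_injective thetaFn hepi hiso hiiid hdivc hdivp)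
    (sgpCupSpec_ofRootData F Q l odd_l N T Acirc AN BN sCap sCup base_map_sCap isPreStep_sCap isPreStep_sCup ρ
      ρ_surjective isOpen_ker_ρ σ K constEmb constEmb_injective thetaFn hepi hiso hiiid hdivc hdivp)
    (strvSection_ofRootData F Q l odd_l N T Acirc AN BN sCap sCup base_map_sCap isPreStep_sCap isPreStep_sCup ρ
      ρ_surjective isOpen_ker_ρ σ K constEmb constEmb_injective thetaFn hepi hiso hiiid hdivc hdivp hσ)
    hdiff hK

end

end ThetaFrobenioid

end Literature.AnabelianGeometry.EtaleTheta
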